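import Literature.AlgebraicGeometry.Motives.GrassmannianZariskiGluing
import Literature.AlgebraicGeometry.Motives.GrassmannianFunctor
import Literature.AlgebraicGeometry.Motives.ZariskiSheavesOnAffineSchemes
import HarnessLib

/-!
# The Grassmannian functor on `CommRingCat` is a Zariski sheaf on affine schemes

Topic `AlgebraicGeometry/Motives`; namespace `Literature.AlgebraicGeometry.Motives.Grassmannian`.
THEOREMS ONLY (no definition, no named fact, no instance, no `sorry`).

[GortzWedhorn2020, (8.4) pp. 213–215 and (8.6) p. 217]: the Grassmannian functor `Grass_k` is a sheaf for the Zariski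
topology.  For ★ `grassmannianFunctor M k : CommRingCat ⥤ Type` (`A ↦ G(k, A ⊗_ℤ M; A)`, Mathlib `Module.Grassmannian`)
this file proves the sheaf property on AFFINE schemes, i.e. for the topology `J₀` induced on `CommRingCatᵒᵖ` by the big
Zariski topology along `Scheme.Spec` — by ★ `ZariskiSheavesOnAffineSchemes` (`isSheaf_unopUnop_comp_iff`) the topology of
the finite standard open coverings `Spec A = ⋃ D(fᵢ)`.  The gluing itself is ★ `GrassmannianZariskiGluing`
(`existsUnique_map_eq_of_map_eq`, abstract models indexed by a finite subset of `A`), here run on Mathlib's standard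
models `Localization.Away (f i)` / `Localization.Away (f i * f j)` for a finite FAMILY `f : ι → A`; every statement is
phrased through `grassmannianFunctor` (`G.obj`, `G.map`), so that only the `ℤ`-structures fixed inside ★
`GrassmannianFunctor` occur.  With ★ `isEquivalence_sheafPushforwardContinuous_Spec` («Zariski sheaves on schemes =
Zariski sheaves on affine schemes») this yields the Grassmannian as a `Type u`-valued Zariski sheaf on `Scheme.{u}`.

* §1 (private) `isLocalization_awayToAwayRight/Left` — `A[1/xy] = A[1/x][1/y] = A[1/y][1/x]` for the standard models;
  `map_eq_of_map_awayToAway_eq` — for `y = x` the overlap condition forces equality (`A[1/x] → A[1/x²]` has a retraction).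
* §2 **`grassmannianFunctor_existsUnique_of_awayToAway`** — `ι`-indexed gluing along `A → Localization.Away (f i)`.
* §3 **`isSheaf_grassmannianFunctor`** — `unopUnop CommRingCat ⋙ grassmannianFunctor M k` is a `J₀`-sheaf (`M : Type u`).

Cell `hodgecm-mathlib` (D-0151), F-DAG first hand (h4) «Grassmannian as a scheme» (B-p21 (g15) author; B-p18 (g17) charts,
B-p09 (g12) sites), count-neutral Mathlib-side capital (brick (D2)).  Nothing here is about HC; HC_CM is proved only modulo
the 7 printed citations until rung 0 closes.

## References
* [GortzWedhorn2020] U. Görtz, T. Wedhorn, *Algebraic Geometry I*, 2nd ed. (2020), (8.4) (pp. 213–215), (8.6) (p. 217),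
  Ch. 8 Exercise 8.1.
* [StacksProject] The Stacks project, Tag 089R (Grassmannians) and Tag 00EO (standard open coverings).
-/

namespace Literature.AlgebraicGeometry.Motives.Grassmannian

open CategoryTheory Opposite TensorProduct IsLocalization _root_.AlgebraicGeometry

universe u v w

/-! ## §1 The standard models of the double localizations -/

section Standard

variable {A : Type u} [CommRing A]

/-- **`A[1/xy] = A[1/x][1/y]`** for Mathlib's standard models: `Localization.Away (x * y)` is the localization of
`Localization.Away x` at the powers of (the image of) `y`, the algebra structure being the canonical map
`IsLocalization.Away.awayToAwayRight x y` (compare with Mathlib's iterated model `Localization.Away (algebraMap _ _ y)`,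
an `A`-localization away from `xy`; the comparison isomorphism is `A[1/x]`-linear because it is `A`-linear). [folklore] -/
private theorem isLocalization_awayToAwayRight (x y : A) :
    @IsLocalization _ _ (.powers (algebraMap A (Localization.Away x) y)) (Localization.Away (x * y)) _
      (IsLocalization.Away.awayToAwayRight (S := Localization.Away x) (P := Localization.Away (x * y)) x y).toAlgebra := by
  set S := Localization.Away x
  set T := Localization.Away (x * y)
  let ψ : S →+* T := IsLocalization.Away.awayToAwayRight (S := S) (P := T) x y
  letI : Algebra S T := ψ.toAlgebra
  haveI : IsScalarTower A S T := IsScalarTower.of_algebraMap_eq fun a =>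
    (IsLocalization.Away.awayToAwayRight_eq (S := S) (P := T) x y a).symm
  let T' := Localization.Away (algebraMap A S y)
  let e : T' ≃ₐ[A] T := IsLocalization.algEquiv (.powers (x * y)) T' T
  have he : (e : T' →+* T).comp (algebraMap S T') = algebraMap S T := by
    apply IsLocalization.ringHom_ext (.powers x)
    rw [RingHom.comp_assoc, ← IsScalarTower.algebraMap_eq, ← IsScalarTower.algebraMap_eq]
    exact e.toAlgHom.comp_algebraMap
  let e' : T' ≃ₐ[S] T := { e with commutes' := fun s => by simpa using congr($he s) }
  exact IsLocalization.isLocalization_of_algEquiv (.powers (algebraMap A S y)) e'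

/-- **`A[1/xy] = A[1/y][1/x]`**, the same for `IsLocalization.Away.awayToAwayLeft y x : Localization.Away y → Localization.Away (x * y)`.
[folklore] -/
private theorem isLocalization_awayToAwayLeft (x y : A) :
    @IsLocalization _ _ (.powers (algebraMap A (Localization.Away y) x)) (Localization.Away (x * y)) _
      (IsLocalization.Away.awayToAwayLeft (S := Localization.Away y) (P := Localization.Away (x * y)) y x).toAlgebra := by
  set S := Localization.Away y
  set T := Localization.Away (x * y)
  let ψ : S →+* T := IsLocalization.Away.awayToAwayLeft (S := S) (P := T) y x
  letI : Algebra S T := ψ.toAlgebra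
  haveI : IsScalarTower A S T := IsScalarTower.of_algebraMap_eq fun a =>
    (IsLocalization.Away.awayToAwayLeft_eq (S := S) (P := T) y x a).symm
  let T' := Localization.Away (algebraMap A S x)
  let e : T' ≃ₐ[A] T := IsLocalization.algEquiv (.powers (x * y)) T' T
  have he : (e : T' →+* T).comp (algebraMap S T') = algebraMap S T := by
    apply IsLocalization.ringHom_ext (.powers y)
    rw [RingHom.comp_assoc, ← IsScalarTower.algebraMap_eq, ← IsScalarTower.algebraMap_eq]
    exact e.toAlgHom.comp_algebraMap
  let e' : T' ≃ₐ[S] T := { e with commutes' := fun s => by simpa using congr($he s) }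
  exact IsLocalization.isLocalization_of_algEquiv (.powers (algebraMap A S x)) e'

variable (M : Type v) [AddCommGroup M] (k : ℕ)

/-- **Degenerate overlaps force equality.**  For `y = x`: if `N₀ ∈ G(A)` restricts to `Ny` over `A[1/y]`, and the
images of `Nx ∈ G(A[1/x])` and `Ny` in `G(A[1/xy])` under `awayToAwayRight x y` resp. `awayToAwayLeft y x` agree, then
`N₀` restricts to `Nx` over `A[1/x]`: the two overlap maps coincide (`A`-algebra maps out of `A[1/x]`), and
`A[1/x] → A[1/x²]` has a retraction, so the Grassmannian functor is injective on it. [folklore] -/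
private theorem map_eq_of_map_awayToAway_eq {x y : A} (hxy : y = x) (N₀ : (grassmannianFunctor.{u, v} M k).obj (.of A))
    (Nx : (grassmannianFunctor.{u, v} M k).obj (.of (Localization.Away x)))
    (Ny : (grassmannianFunctor.{u, v} M k).obj (.of (Localization.Away y)))
    (hy : (grassmannianFunctor.{u, v} M k).map (CommRingCat.ofHom (algebraMap A (Localization.Away y))) N₀ = Ny)
    (h : (grassmannianFunctor.{u, v} M k).map (CommRingCat.ofHom
        (IsLocalization.Away.awayToAwayRight (S := Localization.Away x) (P := Localization.Away (x * y)) x y)) Nx =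
      (grassmannianFunctor.{u, v} M k).map (CommRingCat.ofHom
        (IsLocalization.Away.awayToAwayLeft (S := Localization.Away y) (P := Localization.Away (x * y)) y x)) Ny) :
    (grassmannianFunctor.{u, v} M k).map (CommRingCat.ofHom (algebraMap A (Localization.Away x))) N₀ = Nx := by
  subst hxy hy
  set S := Localization.Away y
  set T := Localization.Away (y * y)
  set ρ : S →+* T := IsLocalization.Away.awayToAwayRight (S := S) (P := T) y y
  -- the two overlap maps coincide
  have hρ : IsLocalization.Away.awayToAwayLeft (S := S) (P := T) y y = ρ := by
    apply IsLocalization.ringHom_ext (.powers y)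
    ext a
    simp only [RingHom.comp_apply, IsLocalization.Away.awayToAwayLeft_eq, ρ, IsLocalization.Away.awayToAwayRight_eq]
  rw [hρ] at h
  -- a retraction of `ρ`
  have hunit : IsUnit (algebraMap A S (y * y)) := by
    rw [map_mul]
    exact (IsLocalization.Away.algebraMap_isUnit y).mul (IsLocalization.Away.algebraMap_isUnit y)
  set θ : T →+* S := IsLocalization.Away.lift (y * y) hunit
  have hθρ : θ.comp ρ = RingHom.id S := by
    apply IsLocalization.ringHom_ext (.powers y)
    ext a
    simp only [RingHom.comp_apply, ρ, IsLocalization.Away.awayToAwayRight_eq, θ, IsLocalization.Away.lift_eq,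
      RingHom.id_apply]
  have hinj : ∀ N : (grassmannianFunctor.{u, v} M k).obj (.of S), (grassmannianFunctor.{u, v} M k).map (CommRingCat.ofHom θ)
      ((grassmannianFunctor.{u, v} M k).map (CommRingCat.ofHom ρ) N) = N := fun N => by
    rw [← Functor.map_comp_apply, ← CommRingCat.ofHom_comp, hθρ, CommRingCat.ofHom_id, Functor.map_id_apply]
  rw [← hinj Nx, h, hinj]

end Standard

/-! ## §2 Gluing along `A → Localization.Away (f i)` -/

section Gluing

variable (M : Type v) [AddCommGroup M] (k : ℕ) {A : Type u} [CommRing A] {ι : Type w} [Finite ι]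
  (f : ι → A) (hf : Ideal.span (Set.range f) = ⊤)

include hf in
/-- **GLUING IN THE GRASSMANNIAN FUNCTOR along a standard open covering, Mathlib's models.**  Let `f : ι → A` be a
finite family generating the unit ideal, `M` an abelian group, `G = grassmannianFunctor M k`.  If
`Nᵢ ∈ G(A[1/fᵢ])` (`A[1/fᵢ] = Localization.Away (f i)`) satisfy `G(awayToAwayRight fᵢ fⱼ) Nᵢ = G(awayToAwayLeft fⱼ fᵢ) Nⱼ`
in `G(A[1/fᵢfⱼ])` (`= Localization.Away (f i * f j)`) for all `i, j`, then there is EXACTLY ONE `N ∈ G(A)` with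
`G(A → A[1/fᵢ]) N = Nᵢ` for every `i` — the sheaf condition of the Grassmannian functor for the standard open covering
`Spec A = ⋃ D(fᵢ)` ([GortzWedhorn2020, (8.6)]; compare Mathlib `IsLocalization.Away.existsUnique_algebraMap_eq_of_span_eq_top`
for the structure sheaf).  Proof: ★ `existsUnique_map_eq_of_map_eq` for the subset `s = range f` with the models
`Localization.Away (f (i a))` for chosen preimages `i a` (`§1` for the localization hypotheses); the passage from the
representatives to all `i` is `map_eq_of_map_awayToAway_eq`.
[cite: GortzWedhorn2020, (8.4) (pp. 213–215) and (8.6) (p. 217)] [cite: StacksProject, Tag 089R] -/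
theorem grassmannianFunctor_existsUnique_of_awayToAway
    (N : ∀ i, (grassmannianFunctor.{u, v} M k).obj (.of (Localization.Away (f i))))
    (hN : ∀ i j, (grassmannianFunctor.{u, v} M k).map (CommRingCat.ofHom
        (IsLocalization.Away.awayToAwayRight (S := Localization.Away (f i)) (P := Localization.Away (f i * f j))
          (f i) (f j))) (N i) =
      (grassmannianFunctor.{u, v} M k).map (CommRingCat.ofHom
        (IsLocalization.Away.awayToAwayLeft (S := Localization.Away (f j)) (P := Localization.Away (f i * f j))
          (f j) (f i))) (N j)) :
    ∃! N₀ : (grassmannianFunctor.{u, v} M k).obj (.of A),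
      ∀ i, (grassmannianFunctor.{u, v} M k).map (CommRingCat.ofHom (algebraMap A (Localization.Away (f i)))) N₀ = N i := by
  classical
  -- representatives of the fibres of `f`
  set s : Set A := Set.range f
  haveI : Finite s := (Set.finite_range f).to_subtype
  have hidx' : ∀ a : s, ∃ i, f i = a := fun a => a.2
  choose idx hidx using hidx'
  -- the models, with the `ℤ`-structures of ★ `grassmannianFunctor` (the canonical `Ring.toIntAlgebra` ones)
  let B : s → Type u := fun a => Localization.Away (f (idx a))
  letI iB : ∀ a : s, Algebra ℤ (B a) := fun _ => Ring.toIntAlgebra _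
  haveI hB : ∀ a : s, IsLocalization.Away (a : A) (B a) := fun a => by
    rw [← hidx a]
    exact Localization.isLocalization
  let B₂ : s → s → Type u := fun a b => Localization.Away (f (idx a) * f (idx b))
  letI iB₂ : ∀ a b : s, Algebra ℤ (B₂ a b) := fun _ _ => Ring.toIntAlgebra _
  letI iA : Algebra ℤ A := Ring.toIntAlgebra _
  let ψl : ∀ a b : s, B a →ₐ[A] B₂ a b := fun a b =>
    { toRingHom := IsLocalization.Away.awayToAwayRight (S := B a) (P := B₂ a b) (f (idx a)) (f (idx b))
      commutes' := fun r => IsLocalization.Away.awayToAwayRight_eq (S := B a) (P := B₂ a b) (f (idx a)) (f (idx b)) r }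
  let ψr : ∀ a b : s, B b →ₐ[A] B₂ a b := fun a b =>
    { toRingHom := IsLocalization.Away.awayToAwayLeft (S := B b) (P := B₂ a b) (f (idx b)) (f (idx a))
      commutes' := fun r => IsLocalization.Away.awayToAwayLeft_eq (S := B b) (P := B₂ a b) (f (idx b)) (f (idx a)) r }
  have hl : ∀ a b : s, @IsLocalization _ _ (.powers (algebraMap A (B a) b)) (B₂ a b) _ (ψl a b).toRingHom.toAlgebra :=
    fun a b => by
    rw [← hidx b]
    exact isLocalization_awayToAwayRight (f (idx a)) (f (idx b))
  have hr : ∀ a b : s, @IsLocalization _ _ (.powers (algebraMap A (B b) a)) (B₂ a b) _ (ψr a b).toRingHom.toAlgebra :=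
    fun a b => by
    rw [← hidx a]
    exact isLocalization_awayToAwayLeft (f (idx a)) (f (idx b))
  -- glue over the representatives
  obtain ⟨N₀, hN₀, huniq⟩ := existsUnique_map_eq_of_map_eq (R := ℤ) (M := M) (k := k) s hf B B₂ ψl ψr hl hr
    (fun a => N (idx a)) (fun a b => hN (idx a) (idx b))
  refine ⟨N₀, fun i => ?_, fun N' hN' => huniq N' fun a => hN' (idx a)⟩
  -- from the representative of `f i` to `i`
  exact map_eq_of_map_awayToAway_eq M k (hidx ⟨f i, i, rfl⟩) N₀ (N i) (N (idx ⟨f i, i, rfl⟩)) (hN₀ ⟨f i, i, rfl⟩)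
    (hN i (idx ⟨f i, i, rfl⟩))

end Gluing

/-! ## §3 The sheaf property on affine schemes -/

section Sheaf

variable (M : Type u) [AddCommGroup M] (k : ℕ)

/-- **THE GRASSMANNIAN FUNCTOR IS A ZARISKI SHEAF ON AFFINE SCHEMES** ([GortzWedhorn2020, (8.6) with (8.4)]):
`unopUnop CommRingCat ⋙ grassmannianFunctor M k`, the presheaf `op A ↦ G(k, A ⊗_ℤ M; A)` on `CommRingCatᵒᵖ` (affine
schemes), is a sheaf for the topology induced by the big Zariski topology along `Scheme.Spec` — by ★
`isSheaf_unopUnop_comp_iff` the topology of finite standard open coverings, for which §2 is the sheaf condition (the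
compatibility hypothesis there is the special case `C = A[1/fᵢfⱼ]` of compatibility).  Hence (★
`isEquivalence_sheafPushforwardContinuous_Spec`) it extends uniquely to a `Type u`-valued Zariski sheaf on `Scheme.{u}`.
[cite: GortzWedhorn2020, (8.4) (pp. 213–215) and (8.6) (p. 217)] [cite: StacksProject, Tag 089R] -/
theorem isSheaf_grassmannianFunctor :
    Presheaf.IsSheaf (Scheme.Spec.inducedTopology Scheme.zariskiTopology.{u})
      (unopUnop CommRingCat.{u} ⋙ grassmannianFunctor.{u, u} M k) := by
  rw [isSheaf_unopUnop_comp_iff]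
  intro A ι _ f hf x hx
  refine grassmannianFunctor_existsUnique_of_awayToAway M k f hf x fun i j => hx i j _ _ _ ?_
  ext r
  change IsLocalization.Away.awayToAwayRight (f i) (f j) (algebraMap A (Localization.Away (f i)) r) =
    IsLocalization.Away.awayToAwayLeft (f j) (f i) (algebraMap A (Localization.Away (f j)) r)
  rw [IsLocalization.Away.awayToAwayRight_eq, IsLocalization.Away.awayToAwayLeft_eq]

end Sheaf

end Literature.AlgebraicGeometry.Motives.Grassmannian
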